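import Summits.CriticalPhenomena.PercolationContinuityZ3.Theorems.PercNearOneGluingNoHeavyConstsMDLXJointXEdgeInduction
import HarnessLib

/-!
# CROSS: the alternating sum of the four Bernstein members is a margin INSIDE `{s ↔ u}` (identity, every added vertex `u`, every functional)

builds on p205010 (kernel theorem, internal audit signed; external expert review pending).  Support file (`--supports
stmt-CriticalPhenomena-4575`); theorems only, no sorries, standard axioms.  Memo `run/shared/lean/prim/consts/FROM-prim-consts-2-g21-GIBBS-ORBIT.md` §3b.

For nested avoided sets `X ⊂ X' = X ∪ {u}` the MDL(X)′ margin of the graph with a pair `x–u` of weight `q` is the cubic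
`(1−q)³M₀ + q(1−q)²M₁ + q²(1−q)M₂ + q³M₃` in the members `M₀ = P(X,X,X)`, `M₁ = P(X',X,X)+P(X,X',X)+P(X,X,X')`, `M₂ = P(X',X',X)+P(X',X,X')+P(X,X',X')`,
`M₃ = P(X',X',X')` (`P = Consts.polMargin`; `Consts.CrossRel` asks `M₁, M₂ ≥ 0`).  Since `P(X₀,X₁,X₂) = μ(T_{X₀})·K_Z(X₁,X₂) − μ(T_{X₀}∩W)·K_Y(X₁,X₂)` is linear in
the copy-0 masses and BILINEAR in the copy-1 data `(μ(D_{X₁}), ∫_{D_{X₁}}F)` and the copy-2 data `(μ(D_{X₂}∩E), ∫_{D_{X₂}∩E}F)`, and `D_X ∖ D_{X'} = D_X ∩ {s↔u}`,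
the fully polarised difference is a margin inside `G = {s ↔ u}`:
* `Consts.polMargin_members_alternating` — **`M₀ − M₁ + M₂ − M₃ = (t − t')·cov_{D∩G}(F; s↔z) − (tw − tw')·cov_{D∩G}(F; s↔y)`** for EVERY `F` and every `u`,
  where `t = μ(T_X)`, `t' = μ(T_{X'})`, `tw = μ(T_X ∩ {y↔z})`, `tw' = μ(T_{X'} ∩ {y↔z})`, `cov_E(F;A) = μ(E)∫_{E∩A}F − (∫_E F)μ(E∩A)`, `D = {s↮X}`.
At `u = z` (`M₃ = 0`, `cov_{D∩Z}(F; s↔z) = 0`, `tw' = 0`) this is `M₁ = M₀ + M₂ + tw·cov_{D∩Z}(F; s↔y)` (`…ConstsCrossZMembers.lean`).  Census (seat prim-consts-2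
gen 21, exact, all edge up-sets, n ≤ 7): the right-hand side is NOT signed (conditioning on the increasing event `{s↔u}` breaks positive association), but
`M₁ ≥ M₃` and `M₂ ≥ 2M₃` held in 380/380 weighted graphs for a generic `u`, and `M₁ ≥ M₀`, `M₁ ≥ M₂` in 350/350 at `u = z`.
[cite: VandenbergHaggstromKahn2005, §2.1 (pp. 9–13)]
-/

noncomputable section

namespace Summit.CriticalPhenomena.PercolationContinuityZ3.Theorems

open MeasureTheory Set Literature.Probability.LatticeModels Literature.Probability.Percolation
open scoped Classical

namespace Consts

variable {V : Type*} [Fintype V]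

/-- **`M₀ − M₁ + M₂ − M₃ = (t − t')·cov_{D∩{s↔u}}(F; s↔z) − (tw − tw')·cov_{D∩{s↔u}}(F; s↔y)`** for every added vertex `u` and every functional `F`
(trilinearity of the polarised margin; `D_X ∖ D_{X∪u} = D_X ∩ {s↔u}`). [cite: VandenbergHaggstromKahn2005, §2.1 (pp. 9–13)] -/
theorem polMargin_members_alternating (μ : Measure (BondConfig V)) [IsFiniteMeasure μ] (s y z u : V) (X : Set V)
    (F : Set (Sym2 V) → ℝ) :
    polMargin μ s y z F X X X
      - (polMargin μ s y z F (insert u X) X X + polMargin μ s y z F X (insert u X) X + polMargin μ s y z F X X (insert u X))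
      + (polMargin μ s y z F (insert u X) (insert u X) X + polMargin μ s y z F (insert u X) X (insert u X) +
          polMargin μ s y z F X (insert u X) (insert u X))
      - polMargin μ s y z F (insert u X) (insert u X) (insert u X) =
      (μ.real ({ω : BondConfig V | ∀ x ∈ insert s X, ¬ (openGraph ω).Reachable y x} ∩ {ω | ∀ x ∈ X, ¬ (openGraph ω).Reachable s x}) -
          μ.real ({ω : BondConfig V | ∀ x ∈ insert s (insert u X), ¬ (openGraph ω).Reachable y x} ∩
            {ω | ∀ x ∈ insert u X, ¬ (openGraph ω).Reachable s x})) *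
        (μ.real ({ω : BondConfig V | ∀ x ∈ X, ¬ (openGraph ω).Reachable s x} ∩ openConn s u) *
            (∫ ω in {ω : BondConfig V | ∀ x ∈ X, ¬ (openGraph ω).Reachable s x} ∩ openConn s z ∩ openConn s u, F (openEdgeCluster ω s) ∂μ) -
          (∫ ω in {ω : BondConfig V | ∀ x ∈ X, ¬ (openGraph ω).Reachable s x} ∩ openConn s u, F (openEdgeCluster ω s) ∂μ) *
            μ.real ({ω : BondConfig V | ∀ x ∈ X, ¬ (openGraph ω).Reachable s x} ∩ openConn s z ∩ openConn s u)) -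
      (μ.real ({ω : BondConfig V | ∀ x ∈ insert s X, ¬ (openGraph ω).Reachable y x} ∩ {ω | ∀ x ∈ X, ¬ (openGraph ω).Reachable s x} ∩
            openConn y z) -
          μ.real ({ω : BondConfig V | ∀ x ∈ insert s (insert u X), ¬ (openGraph ω).Reachable y x} ∩
            {ω | ∀ x ∈ insert u X, ¬ (openGraph ω).Reachable s x} ∩ openConn y z)) *
        (μ.real ({ω : BondConfig V | ∀ x ∈ X, ¬ (openGraph ω).Reachable s x} ∩ openConn s u) *
            (∫ ω in {ω : BondConfig V | ∀ x ∈ X, ¬ (openGraph ω).Reachable s x} ∩ openConn s y ∩ openConn s u, F (openEdgeCluster ω s) ∂μ) -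
          (∫ ω in {ω : BondConfig V | ∀ x ∈ X, ¬ (openGraph ω).Reachable s x} ∩ openConn s u, F (openEdgeCluster ω s) ∂μ) *
            μ.real ({ω : BondConfig V | ∀ x ∈ X, ¬ (openGraph ω).Reachable s x} ∩ openConn s y ∩ openConn s u)) := by
  set D : Set (BondConfig V) := {ω | ∀ x ∈ X, ¬ (openGraph ω).Reachable s x} with hD
  set D' : Set (BondConfig V) := {ω | ∀ x ∈ insert u X, ¬ (openGraph ω).Reachable s x} with hD'
  set A : Set (BondConfig V) := {ω | ∀ x ∈ insert s X, ¬ (openGraph ω).Reachable y x} with hA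
  set A' : Set (BondConfig V) := {ω | ∀ x ∈ insert s (insert u X), ¬ (openGraph ω).Reachable y x} with hA'
  set Y : Set (BondConfig V) := openConn s y with hY
  set Z : Set (BondConfig V) := openConn s z with hZ
  set G : Set (BondConfig V) := openConn s u with hG
  -- set identities
  have hD'eq : D' = D \ G := by
    ext ω
    simp only [hD', hD, hG, Set.mem_setOf_eq, Set.forall_mem_insert, Set.mem_sdiff, openConn]
    tauto
  have hD'Z : D' ∩ Z = (D ∩ Z) \ G := by rw [hD'eq, Set.inter_sdiff_right_comm]
  have hD'Y : D' ∩ Y = (D ∩ Y) \ G := by rw [hD'eq, Set.inter_sdiff_right_comm]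
  -- base quantities
  set t := μ.real (A ∩ D) with ht
  set tw := μ.real (A ∩ D ∩ openConn y z) with htw
  set t' := μ.real (A' ∩ D') with ht'
  set tw' := μ.real (A' ∩ D' ∩ openConn y z) with htw'
  set d := μ.real D with hd
  set dy := μ.real (D ∩ Y) with hdy
  set dz := μ.real (D ∩ Z) with hdz
  set dG := μ.real (D ∩ G) with hdG
  set dyG := μ.real (D ∩ Y ∩ G) with hdyG
  set dzG := μ.real (D ∩ Z ∩ G) with hdzG
  set f := ∫ ω in D, F (openEdgeCluster ω s) ∂μ with hf
  set fy := ∫ ω in D ∩ Y, F (openEdgeCluster ω s) ∂μ with hfy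
  set fz := ∫ ω in D ∩ Z, F (openEdgeCluster ω s) ∂μ with hfz
  set fG := ∫ ω in D ∩ G, F (openEdgeCluster ω s) ∂μ with hfG
  set fyG := ∫ ω in D ∩ Y ∩ G, F (openEdgeCluster ω s) ∂μ with hfyG
  set fzG := ∫ ω in D ∩ Z ∩ G, F (openEdgeCluster ω s) ∂μ with hfzG
  have hmeas : ∀ U : Set (BondConfig V), MeasurableSet U := fun _ => MeasurableSet.of_discrete
  have hint : ∀ S : Set (BondConfig V), IntegrableOn (fun ω => F (openEdgeCluster ω s)) S μ := fun S =>
    (Integrable.of_finite (f := fun ω => F (openEdgeCluster ω s))).integrableOn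
  -- the primed copy-1 / copy-2 quantities in terms of the base ones
  have e_d' : μ.real D' = d - dG := by
    have h := measureReal_inter_add_sdiff (μ := μ) (s := D) (hmeas G)
    rw [hD'eq]; linarith
  have e_f' : ∫ ω in D', F (openEdgeCluster ω s) ∂μ = f - fG := by
    have h := integral_inter_add_sdiff (μ := μ) (s := D) (hmeas G) (hint D)
    rw [hD'eq]; linarith
  have e_dz' : μ.real (D' ∩ Z) = dz - dzG := by
    have h := measureReal_inter_add_sdiff (μ := μ) (s := D ∩ Z) (hmeas G)
    rw [hD'Z]; linarith
  have e_fz' : ∫ ω in D' ∩ Z, F (openEdgeCluster ω s) ∂μ = fz - fzG := by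
    have h := integral_inter_add_sdiff (μ := μ) (s := D ∩ Z) (hmeas G) (hint (D ∩ Z))
    rw [hD'Z]; linarith
  have e_dy' : μ.real (D' ∩ Y) = dy - dyG := by
    have h := measureReal_inter_add_sdiff (μ := μ) (s := D ∩ Y) (hmeas G)
    rw [hD'Y]; linarith
  have e_fy' : ∫ ω in D' ∩ Y, F (openEdgeCluster ω s) ∂μ = fy - fyG := by
    have h := integral_inter_add_sdiff (μ := μ) (s := D ∩ Y) (hmeas G) (hint (D ∩ Y))
    rw [hD'Y]; linarith
  unfold polMargin
  simp only [← hD, ← hD', ← hA, ← hA', ← hY, ← hZ]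
  simp only [e_d', e_f', e_dz', e_fz', e_dy', e_fy', ← ht, ← htw, ← ht', ← htw', ← hd, ← hdy, ← hdz, ← hf, ← hfy, ← hfz]
  ring

end Consts

end Summit.CriticalPhenomena.PercolationContinuityZ3.Theorems
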